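import Literature.Computability.Complexity.NTIMEPadding
import Literature.Computability.Complexity.StringEquality
import Literature.Computability.Complexity.CookReducibilityTransitive
import Literature.Computability.Complexity.CircuitLowerBounds
import Literature.Computability.MetaComplexity.UniversalMachineProofs
import HarnessLib

/-!
# The language of a clocked universal machine is in `NEXP` (verifier construction)

Literature / complexity toolkit (serves the easy-witness decomposition: the named fact
`exists_NEXP_universal_for_NTIME_two_pow` of `EasyWitnessUniversal.lean`, the machine `U` of
Impagliazzo–Kabanets–Wigderson's proof of their Lemma 5, is to be derived from the tree's
universal-machine fact
`Literature.Computability.MetaComplexity.UniversalMachine.clockedUniversalSimulation`,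
Arora–Barak Thm. 1.9). Given ANY clocked interpreter `run : {0,1}* → ℕ → Option {0,1}*` whose
graph `(prog, 1ᵗ) ↦ run prog t` is computed by a TM2 machine `MU` in polynomial time, this file
builds the `NTIME(2^{m⁴})` verifier of the language

  `K = {w = ⟨e, x⟩ | ∃ y, |y| ≤ 2^{m²} + 1 ∧ run ⟨e, ⟨x, y⟩⟩ (2^{m³} + 1) = some [1]}`, `m = |w|`,

("on input `(i, x)` … simulate the `i`th nondeterministic machine for exponentially many steps",
IKW; the exponents `m², m³, m⁴` leave room for the machine-dependent polynomial overheads).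
The verifier on `⟨w, y⟩` is the composite of four machines of the tree:

1. `exists_univClock_machine`, `exists_univTrunc_machine` — the clock `w ↦ ⟨⟨w, 1^{2^{m³}+1}⟩,
   1^{2^{m²}+1}⟩` (two `expClock` programs of `NTIMEPadding.lean`, the inner one under
   `mapFstAux`) feeding the truncating wrapper `truncMapAux` (`TruncMapMachine.lean`): output
   `⟨⟨w, 1^{2^{m³}+1}⟩, y ↾ (2^{m²}+1)⟩`, the excess witness read two symbols per step;
2. `exists_rearrange_machine` — the `FP` plumbing `⟨⟨w, v⟩, y'⟩ ↦ ⟨⟨fst w, ⟨snd w, y'⟩⟩, v⟩`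
   (`fanoutFn`, `Brick.fstF/sndF`), producing the interpreter's input `⟨prog, 1ᵗ⟩`;
3. the interpreter `MU` itself;
4. `exists_isSomeTrue_machine` — the `FP` test `z ↦ [z = enc (some [1])]` (`eqPairFn`).

Main statements: `exists_univ_verifier` (the composite outputs `[R_K w y]` within
`K₀·2^{m⁴} + K₀ + |y|/2` steps on EVERY pair — all intermediate words have length `O(2^{m³})`,
every polynomial of `2^{m³}` is `O(2^{m⁴})`, `exists_eval_two_pow_cube_le`) and
**`exists_univLang_mem_NTIME`**: `K ∈ NTIME(2^{m⁴})`, stated existentially (no new definitions).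
The reduction of every `NTIME(2ⁿ)` language to `K` (universality) is `UniversalNEXPLanguage.lean`.

## References

* S. Arora, B. Barak, *Computational Complexity: A Modern Approach*, CUP 2009, Thm. 1.9 and
  §1.4.1 (clocked universal machine), §2.1.2 / Exercise 2.6 (universal NDTM), §1.3.
* R. Impagliazzo, V. Kabanets, A. Wigderson, *In search of an easy witness*, JCSS 65 (2002),
  proof of Lemma 5.
-/

namespace Literature.Computability.Complexity

open _root_.Computability Turing Polynomial

/-! ### Arithmetic of the clocks -/

/-- `2^{m^j} ≤ 2^{m^k}` for `1 ≤ j ≤ k` (also at `m = 0`). [folklore] -/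
theorem two_pow_pow_mono {m j k : ℕ} (hj : 1 ≤ j) (h : j ≤ k) : 2 ^ (m ^ j) ≤ 2 ^ (m ^ k) := by
  rcases Nat.eq_zero_or_pos m with rfl | hm
  · rw [zero_pow (by omega), zero_pow (by omega)]
  · exact Nat.pow_le_pow_right (by norm_num) (Nat.pow_le_pow_right hm h)

/-- `m ≤ 2^{m³}`. [folklore] -/
theorem le_two_pow_cube (m : ℕ) : m ≤ 2 ^ (m ^ 3) := by
  have h := two_pow_pow_mono (m := m) (j := 1) (k := 3) le_rfl (by norm_num)
  rw [pow_one] at h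
  exact Nat.lt_two_pow_self.le.trans h

/-- `2^{d·m³} ≤ 2^{m⁴} + 2^{d⁴}` (split on `d ≤ m`). [folklore] -/
theorem two_pow_mul_cube_le (d m : ℕ) : 2 ^ (d * m ^ 3) ≤ 2 ^ (m ^ 4) + 2 ^ (d ^ 4) := by
  rcases le_or_gt d m with h | h
  · have : d * m ^ 3 ≤ m ^ 4 := by
      calc d * m ^ 3 ≤ m * m ^ 3 := Nat.mul_le_mul_right _ h
        _ = m ^ 4 := by ring
    exact le_add_right (Nat.pow_le_pow_right (by norm_num) this)
  · have : d * m ^ 3 ≤ d ^ 4 := by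
      calc d * m ^ 3 ≤ d * d ^ 3 := Nat.mul_le_mul_left _ (Nat.pow_le_pow_left h.le 3)
        _ = d ^ 4 := by ring
    exact le_add_left (Nat.pow_le_pow_right (by norm_num) this)

/-- **Every polynomial of `2^{m³}` is `O(2^{m⁴})`**: `Q(2^{m³}) ≤ K·2^{m⁴} + K` with
`K = Q(1)·2^{(deg Q)⁴}`. [folklore] -/
theorem exists_eval_two_pow_cube_le (Q : Polynomial ℕ) :
    ∃ K : ℕ, ∀ m : ℕ, Q.eval (2 ^ (m ^ 3)) ≤ K * 2 ^ (m ^ 4) + K := by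
  refine ⟨Q.eval 1 * 2 ^ (Q.natDegree ^ 4), fun m => ?_⟩
  have h1 := natPoly_eval_le_eval_one_mul_pow Q (n := 2 ^ (m ^ 3)) Nat.one_le_two_pow
  rw [← pow_mul, mul_comm (m ^ 3)] at h1
  have h2 := two_pow_mul_cube_le Q.natDegree m
  have hB : 1 ≤ 2 ^ (Q.natDegree ^ 4) := Nat.one_le_two_pow
  have h3 : Q.eval 1 * 2 ^ (m ^ 4) ≤ Q.eval 1 * 2 ^ (Q.natDegree ^ 4) * 2 ^ (m ^ 4) := by
    calc Q.eval 1 * 2 ^ (m ^ 4) = Q.eval 1 * 1 * 2 ^ (m ^ 4) := by ring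
      _ ≤ _ := Nat.mul_le_mul_right _ (Nat.mul_le_mul_left _ hB)
  calc Q.eval (2 ^ (m ^ 3)) ≤ Q.eval 1 * 2 ^ (Q.natDegree * m ^ 3) := h1
    _ ≤ Q.eval 1 * (2 ^ (m ^ 4) + 2 ^ (Q.natDegree ^ 4)) := Nat.mul_le_mul_left _ h2
    _ = Q.eval 1 * 2 ^ (m ^ 4) + Q.eval 1 * 2 ^ (Q.natDegree ^ 4) := mul_add _ _ _
    _ ≤ Q.eval 1 * 2 ^ (Q.natDegree ^ 4) * 2 ^ (m ^ 4) + Q.eval 1 * 2 ^ (Q.natDegree ^ 4) :=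
        Nat.add_le_add_right h3 _

/-! ### Stage 1: the double clock and the truncation of the witness -/

/-- **The double clock** `w ↦ ⟨⟨w, 1^{2^{m³}+1}⟩, 1^{2^{m²}+1}⟩`, `m = |w|`, within
`c·2^{m³} + c` steps: the `expClock 1 2` program followed by the `expClock 1 3` program run
under `mapFstAux` (`MapFstMachine.lean`). [folklore] -/
theorem exists_univClock_machine :
    ∃ (c : ℕ) (N : TM2ComputableAux Bool Bool), ∀ w : List Bool,
      N.OutputsWithin w
        (boolPair (expClock 1 3 w) (List.replicate (1 * 2 ^ (w.length ^ 2) + 1) true))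
        (c * 2 ^ (w.length ^ 3) + c) := by
  obtain ⟨C₂, Ck₂, hC₂⟩ := exists_timeComputable_expClock 1 (k := 2) (by norm_num)
  obtain ⟨C₃, Ck₃, hC₃⟩ := exists_timeComputable_expClock 1 (k := 3) (by norm_num)
  refine ⟨C₂ + C₃ + 30, Ck₂.comp (mapFstAux Ck₃), fun w => ?_⟩
  have h₁ : Ck₂.OutputsWithin w (expClock 1 2 w) (C₂ * 2 ^ (w.length ^ 2) + C₂) := hC₂ w
  have h₃ : Ck₃.OutputsWithin (boolUnpair (expClock 1 2 w)).1 (expClock 1 3 w)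
      (C₃ * 2 ^ (w.length ^ 3) + C₃) := by
    rw [boolUnpair_expClock]
    exact hC₃ w
  have h₂ := outputsWithin_mapFstAux Ck₃ h₃
  have hr : PairFstTM.readRest (expClock 1 2 w) =
      List.replicate (1 * 2 ^ (w.length ^ 2) + 1) true := by
    simp only [expClock, readRest_boolPair]
  rw [hr] at h₂
  refine (Turing.TM2ComputableAux.comp_outputsWithin _ _ h₁ h₂).mono ?_
  simp only [length_expClock]
  have hm : w.length ≤ 2 ^ (w.length ^ 3) := le_two_pow_cube _
  have h22 : 2 ^ (w.length ^ 2) ≤ 2 ^ (w.length ^ 3) := two_pow_pow_mono (by norm_num) (by norm_num)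
  have hE : 1 ≤ 2 ^ (w.length ^ 3) := Nat.one_le_two_pow
  have hc₂ : C₂ * 2 ^ (w.length ^ 2) ≤ C₂ * 2 ^ (w.length ^ 3) := Nat.mul_le_mul_left _ h22
  have e : (C₂ + C₃ + 30) * 2 ^ (w.length ^ 3) =
      C₂ * 2 ^ (w.length ^ 3) + C₃ * 2 ^ (w.length ^ 3) + 30 * 2 ^ (w.length ^ 3) := by ring
  omega

/-- **The truncation stage**: a machine that on EVERY pair `⟨w, y⟩` outputs
`⟨⟨w, 1^{2^{m³}+1}⟩, y ↾ (2^{m²}+1)⟩` within `c·2^{m³} + c + |y|/2` steps (the double clock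
under the truncating wrapper `truncMapAux`, which reads the discarded part of `y` two symbols
per step). [cite: AroraBarakCC2009, §1.3] -/
theorem exists_univTrunc_machine :
    ∃ (c : ℕ) (Tr : TM2ComputableAux Bool Bool), ∀ w y : List Bool,
      Tr.OutputsWithin (boolPair w y)
        (boolPair (expClock 1 3 w) (y.take (1 * 2 ^ (w.length ^ 2) + 1)))
        (c * 2 ^ (w.length ^ 3) + c + y.length / 2) := by
  obtain ⟨c₁, N, hN⟩ := exists_univClock_machine
  refine ⟨c₁ + 30, truncMapAux N, fun w y => ?_⟩
  have h := outputsWithin_truncMapAux_boolPair N (y := y) (hN w)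
  simp only [List.length_replicate] at h
  refine h.mono ?_
  simp only [length_expClock]
  have hm : w.length ≤ 2 ^ (w.length ^ 3) := le_two_pow_cube _
  have h22 : 2 ^ (w.length ^ 2) ≤ 2 ^ (w.length ^ 3) := two_pow_pow_mono (by norm_num) (by norm_num)
  have hE : 1 ≤ 2 ^ (w.length ^ 3) := Nat.one_le_two_pow
  have e : (c₁ + 30) * 2 ^ (w.length ^ 3) = c₁ * 2 ^ (w.length ^ 3) + 30 * 2 ^ (w.length ^ 3) := by
    ring
  omega

/-! ### Stage 2: the `FP` plumbing around the interpreter -/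

/-- **Rearranging for the interpreter**: `⟨⟨w, v⟩, y⟩ ↦ ⟨⟨fst w, ⟨snd w, y⟩⟩, v⟩` is computed by
some machine in polynomial time (a `fanoutFn` of projections `Brick.fstF/sndF`).
[cite: AroraBarakCC2009, §1.3] -/
theorem exists_rearrange_machine :
    ∃ (p : Polynomial ℕ) (M : TM2ComputableAux Bool Bool), ∀ w v y : List Bool,
      M.OutputsWithin (boolPair (boolPair w v) y)
        (boolPair (boolPair (boolUnpair w).1 (boolPair (boolUnpair w).2 y)) v)
        (p.eval (boolPair (boolPair w v) y).length) := by
  have hF : fanoutFn (fanoutFn (Brick.fstF ∘ (Brick.fstF ∘ Brick.fstF))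
      (fanoutFn (Brick.sndF ∘ (Brick.fstF ∘ Brick.fstF)) Brick.sndF)) (Brick.sndF ∘ Brick.fstF) ∈ FP :=
    fanoutFn_mem_FP
      (fanoutFn_mem_FP (comp_mem_FP Brick.fstF_mem_FP (comp_mem_FP Brick.fstF_mem_FP Brick.fstF_mem_FP))
        (fanoutFn_mem_FP (comp_mem_FP Brick.sndF_mem_FP (comp_mem_FP Brick.fstF_mem_FP Brick.fstF_mem_FP))
          Brick.sndF_mem_FP))
      (comp_mem_FP Brick.sndF_mem_FP Brick.fstF_mem_FP)
  obtain ⟨p, M, hM⟩ := hF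
  refine ⟨p, M, fun w v y => ?_⟩
  have h := hM (boolPair (boolPair w v) y)
  simpa [fanoutFn_apply, Brick.fstF, Brick.sndF, boolUnpair_boolPair] using h

/-- **The acceptance test**: `z ↦ [z = 11]` (`11 = enc (some [1])` in the option-of-string
encoding) is computed by some machine in polynomial time (`eqPairFn` after pairing with the
constant). [cite: AroraBarakCC2009, §1.3] -/
theorem exists_isSomeTrue_machine :
    ∃ (p : Polynomial ℕ) (M : TM2ComputableAux Bool Bool), ∀ z : List Bool,
      M.OutputsWithin z [decide (z = [true, true])] (p.eval z.length) := by
  have hG : eqPairFn ∘ fanoutFn id (fun _ => [true, true]) ∈ FP :=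
    comp_mem_FP eqPairFn_mem_FP (fanoutFn_mem_FP OracleCompose.id_mem_FP (const_mem_FP _))
  obtain ⟨p, M, hM⟩ := hG
  refine ⟨p, M, fun z => ?_⟩
  simpa [fanoutFn_apply, eqPairFn_boolPair] using hM z

/-- The option-of-string code of `o` is `11` iff `o = some [1]`. [folklore] -/
theorem optionBool_encode_eq_iff (o : Option (List Bool)) :
    ((encodingList Bool).optionBool).encode o = [true, true] ↔ o = some [true] := by
  cases o with
  | none => simp [Encoding.optionBool]
  | some l =>
    simp only [Encoding.optionBool, Option.some.injEq, List.cons.injEq, true_and]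
    exact Iff.rfl

/-! ### Stage 3: the simulation stage and the whole verifier -/

/-- **The simulation stage** `S = rearrange ∘ MU ∘ test`: on `⟨⟨w, 1ᵗ⟩, y⟩` it outputs
`[run ⟨fst w, ⟨snd w, y⟩⟩ t = some [1]]` within `P(ℓ)` steps, `ℓ` the input length, for an
explicit polynomial `P` (outputs of a polynomial-time machine are polynomially long,
`TM2Comp.length_le_of_outputsWithin`). [cite: AroraBarakCC2009, §1.3] -/
theorem exists_sim_stage (run : List Bool → ℕ → Option (List Bool)) {pU : Polynomial ℕ}
    {MU : TM2ComputableAux Bool Bool}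
    (hMU : ∀ (prog : List Bool) (t : ℕ), MU.OutputsWithin (boolPair prog (unaryEncodeNat t))
      (((encodingList Bool).optionBool).encode (run prog t))
      (pU.eval (boolPair prog (unaryEncodeNat t)).length)) :
    ∃ (P : Polynomial ℕ) (S : TM2ComputableAux Bool Bool), ∀ (w y : List Bool) (t : ℕ),
      S.OutputsWithin (boolPair (boolPair w (unaryEncodeNat t)) y)
        [decide (run (boolPair (boolUnpair w).1 (boolPair (boolUnpair w).2 y)) t = some [true])]
        (P.eval (boolPair (boolPair w (unaryEncodeNat t)) y).length) := by
  obtain ⟨pF, MF, hMF⟩ := exists_rearrange_machine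
  obtain ⟨pG, MG, hMG⟩ := exists_isSomeTrue_machine
  set DF := TM2Comp.machinePushBound MF.tm with hDF
  set DU := TM2Comp.machinePushBound MU.tm with hDU
  let L₂ : Polynomial ℕ := X + Polynomial.C DF * pF
  refine ⟨pF + pU.comp L₂ + pG.comp (L₂ + Polynomial.C DU * pU.comp L₂), MF.comp (MU.comp MG),
    fun w y t => ?_⟩
  set z₁ := boolPair (boolPair w (unaryEncodeNat t)) y with hz₁
  set prog := boolPair (boolUnpair w).1 (boolPair (boolUnpair w).2 y) with hprog
  have h₁ : MF.OutputsWithin z₁ (boolPair prog (unaryEncodeNat t)) (pF.eval z₁.length) := hMF w _ y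
  have hℓ₂ : (boolPair prog (unaryEncodeNat t)).length ≤ z₁.length + DF * pF.eval z₁.length :=
    TM2Comp.length_le_of_outputsWithin MF h₁
  have h₂ := hMU prog t
  have hℓ₃ := TM2Comp.length_le_of_outputsWithin MU h₂
  have h₃ := hMG (((encodingList Bool).optionBool).encode (run prog t))
  have hout : decide ((((encodingList Bool).optionBool).encode (run prog t)) = [true, true]) =
      decide (run prog t = some [true]) :=
    Bool.decide_congr (optionBool_encode_eq_iff _)
  rw [hout] at h₃
  have h := Turing.TM2ComputableAux.comp_outputsWithin _ _ h₁
    (Turing.TM2ComputableAux.comp_outputsWithin _ _ h₂ h₃)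
  refine h.mono ?_
  -- the three polynomial times against `P(ℓ₁)`
  have hL₂ : (boolPair prog (unaryEncodeNat t)).length ≤ L₂.eval z₁.length := by
    simpa [L₂] using hℓ₂
  have m2 : pU.eval (boolPair prog (unaryEncodeNat t)).length ≤ pU.eval (L₂.eval z₁.length) :=
    natPoly_eval_mono _ hL₂
  have m3 : pG.eval (((encodingList Bool).optionBool).encode (run prog t)).length ≤
      pG.eval (L₂.eval z₁.length + DU * pU.eval (L₂.eval z₁.length)) :=
    natPoly_eval_mono _ (hℓ₃.trans (Nat.add_le_add hL₂ (Nat.mul_le_mul_left _ m2)))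
  simp only [eval_add, eval_comp, eval_mul, eval_C]
  omega

/-- **The verifier of the universal language**: for every clocked interpreter `run` with a
polynomial-time machine for `(prog, 1ᵗ) ↦ run prog t`, some machine outputs, on EVERY pair
`⟨w, y⟩`, the bit `[run ⟨fst w, ⟨snd w, y ↾ (2^{m²}+1)⟩⟩ (2^{m³}+1) = some [1]]`, `m = |w|`, within
`K₀·2^{m⁴} + K₀ + |y|/2` steps (truncation stage, then the simulation stage on a word of length
`≤ 16·2^{m³}`; `exists_eval_two_pow_cube_le`). [cite: AroraBarakCC2009, Thm. 1.9 and §2.1.2] -/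
theorem exists_univ_verifier (run : List Bool → ℕ → Option (List Bool)) {pU : Polynomial ℕ}
    {MU : TM2ComputableAux Bool Bool}
    (hMU : ∀ (prog : List Bool) (t : ℕ), MU.OutputsWithin (boolPair prog (unaryEncodeNat t))
      (((encodingList Bool).optionBool).encode (run prog t))
      (pU.eval (boolPair prog (unaryEncodeNat t)).length)) :
    ∃ (K₀ : ℕ) (V : TM2ComputableAux Bool Bool), ∀ w y : List Bool,
      V.OutputsWithin (boolPair w y)
        [decide (run (boolPair (boolUnpair w).1
            (boolPair (boolUnpair w).2 (y.take (1 * 2 ^ (w.length ^ 2) + 1))))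
            (1 * 2 ^ (w.length ^ 3) + 1) = some [true])]
        (K₀ * 2 ^ (w.length ^ 4) + K₀ + y.length / 2) := by
  obtain ⟨c, Tr, hTr⟩ := exists_univTrunc_machine
  obtain ⟨P, S, hS⟩ := exists_sim_stage run hMU
  obtain ⟨K, hK⟩ := exists_eval_two_pow_cube_le
    (Polynomial.C c * X + Polynomial.C c + P.comp (Polynomial.C 16 * X))
  refine ⟨K, Tr.comp S, fun w y => ?_⟩
  have h₁ := hTr w y
  rw [expClock, ← OracleCompose.unaryEncodeNat_eq_replicate] at h₁
  have h₂ := hS w (y.take (1 * 2 ^ (w.length ^ 2) + 1)) (1 * 2 ^ (w.length ^ 3) + 1)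
  refine (Turing.TM2ComputableAux.comp_outputsWithin _ _ h₁ h₂).mono ?_
  -- the word entering the simulation stage has length `≤ 16 · 2^{m³}`
  have hm : w.length ≤ 2 ^ (w.length ^ 3) := le_two_pow_cube _
  have h22 : 2 ^ (w.length ^ 2) ≤ 2 ^ (w.length ^ 3) := two_pow_pow_mono (by norm_num) (by norm_num)
  have hE : 1 ≤ 2 ^ (w.length ^ 3) := Nat.one_le_two_pow
  have hℓ : (boolPair (boolPair w (unaryEncodeNat (1 * 2 ^ (w.length ^ 3) + 1)))
      (y.take (1 * 2 ^ (w.length ^ 2) + 1))).length ≤ 16 * 2 ^ (w.length ^ 3) := by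
    have ht : (y.take (1 * 2 ^ (w.length ^ 2) + 1)).length ≤ 1 * 2 ^ (w.length ^ 2) + 1 :=
      List.length_take_le _ _
    simp only [length_boolPair, OracleCompose.unaryEncodeNat_eq_replicate, List.length_replicate]
    omega
  have hP := natPoly_eval_mono P hℓ
  have hQ := hK w.length
  simp only [eval_add, eval_mul, eval_C, eval_X, eval_comp] at hQ
  omega

/-- **The universal language is in `NTIME(2^{m⁴})`** (stated without new definitions): for every
clocked interpreter `run` with a polynomial-time machine for `(prog, 1ᵗ) ↦ run prog t`, the
language `K = {w | ∃ y, |y| ≤ 2^{m²} + 1 ∧ run ⟨fst w, ⟨snd w, y⟩⟩ (2^{m³}+1) = some [1]}`,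
`m = |w|`, is in the tree's `NTIME (2 ^ (· ^ 4))`, with the verifier of `exists_univ_verifier` and
relation `R w y = [run ⟨fst w, ⟨snd w, y ↾ (2^{m²}+1)⟩⟩ (2^{m³}+1) = some [1]]` (the machine `U`
of IKW's proof of Lemma 5, "runs in time `2^{2n}` simulating `Mᵢ`", in the tree's verifier form).
[cite: ImpagliazzoKabanetsWigderson2002, Lemma 5 (proof)] [cite: AroraBarakCC2009, §2.1.2] -/
theorem exists_univLang_mem_NTIME (run : List Bool → ℕ → Option (List Bool)) {pU : Polynomial ℕ}
    {MU : TM2ComputableAux Bool Bool}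
    (hMU : ∀ (prog : List Bool) (t : ℕ), MU.OutputsWithin (boolPair prog (unaryEncodeNat t))
      (((encodingList Bool).optionBool).encode (run prog t))
      (pU.eval (boolPair prog (unaryEncodeNat t)).length)) :
    ∃ K : Language Bool, K ∈ NTIME (fun m => 2 ^ (m ^ 4)) ∧
      ∀ w : List Bool, w ∈ K ↔ ∃ y : List Bool, y.length ≤ 2 ^ (w.length ^ 2) + 1 ∧
        run (boolPair (boolUnpair w).1 (boolPair (boolUnpair w).2 y)) (2 ^ (w.length ^ 3) + 1) =
          some [true] := by
  obtain ⟨K₀, V, hV⟩ := exists_univ_verifier run hMU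
  refine ⟨{w | ∃ y : List Bool, y.length ≤ 2 ^ (w.length ^ 2) + 1 ∧
      run (boolPair (boolUnpair w).1 (boolPair (boolUnpair w).2 y)) (2 ^ (w.length ^ 3) + 1) =
        some [true]}, ?_, fun w => Iff.rfl⟩
  refine ⟨2 * K₀ + 2, fun w y => decide (run (boolPair (boolUnpair w).1
      (boolPair (boolUnpair w).2 (y.take (2 ^ (w.length ^ 2) + 1)))) (2 ^ (w.length ^ 3) + 1) =
        some [true]), V, fun w y hy => ?_, fun w => ?_⟩
  · -- running time inside the window
    have h := hV w y
    simp only [one_mul] at h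
    have e : ∀ b : Bool, encodeBool b = [b] := fun b => by cases b <;> rfl
    rw [e]
    refine h.mono ?_
    have hy : y.length ≤ (2 * K₀ + 2) * 2 ^ (w.length ^ 4) + (2 * K₀ + 2) := hy
    have e4 : (2 * K₀ + 2) * 2 ^ (w.length ^ 4) =
        2 * (K₀ * 2 ^ (w.length ^ 4)) + 2 * 2 ^ (w.length ^ 4) := by
      ring
    show _ ≤ (2 * K₀ + 2) * 2 ^ (w.length ^ 4) + (2 * K₀ + 2)
    omega
  · -- the admissible witnesses
    change (∃ y : List Bool, y.length ≤ 2 ^ (w.length ^ 2) + 1 ∧ _) ↔ _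
    constructor
    · rintro ⟨y, hy, hrun⟩
      refine ⟨y, ?_, ?_⟩
      · have h24 : 2 ^ (w.length ^ 2) ≤ 2 ^ (w.length ^ 4) := two_pow_pow_mono (by norm_num) (by norm_num)
        have e4 : (2 * K₀ + 2) * 2 ^ (w.length ^ 4) =
            2 * (K₀ * 2 ^ (w.length ^ 4)) + 2 * 2 ^ (w.length ^ 4) := by ring
        show y.length ≤ (2 * K₀ + 2) * 2 ^ (w.length ^ 4) + (2 * K₀ + 2)
        omega
      · show decide (run (boolPair (boolUnpair w).1
            (boolPair (boolUnpair w).2 (y.take (2 ^ (w.length ^ 2) + 1)))) (2 ^ (w.length ^ 3) + 1) =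
              some [true]) = true
        rw [List.take_of_length_le hy, hrun]
        simp
    · rintro ⟨y, -, h⟩
      exact ⟨y.take (2 ^ (w.length ^ 2) + 1), List.length_take_le _ _, of_decide_eq_true h⟩

end Literature.Computability.Complexity
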